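import Summits.QuantumFields.YangMills.Theorems.BalabanUVNodesN12Thm1EUAtFlatDatumAllIndices
import Literature.MathematicalPhysics.QuantumFieldTheory.Balaban1983to89.B11Thm1ExistsUniqueInductionGBridges
import Literature.MathematicalPhysics.QuantumFieldTheory.Balaban1983to89.B15Eq177GaugeInvariance
import Summits.QuantumFields.YangMills.Theorems.BalabanUVNodesK0TopIndexWrapGeometry
import HarnessLib

/-!
# DAG node N12 [B15] — A2 WITNESS FOR THE (E∕U) STEP TOKENS: THE SUPPLY TOKEN's AND THE LIFT TOKEN's BODIES AT THE FLAT DATUM `W := M˙(1)`, FOR EVERY INDEX OF RECORD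
# (the g30-pattern vacuity audit of `Literature/…/B11Thm1ExistsUniqueStepTokensG` ✓p755261 and `…/B11Thm1ExistsUniqueInductionG` ✓p756040)

Cell `pub-ymgap` (HUMAN RULINGS D-0062 ∕ D-0149), lane `pub-ymgap-dag-n12-c` g33 (R134 seat (a), N12 = [B15], s1, lane owner).  `--kind proof --supports stmt-QuantumFields-27364 --as helper`
(K1⁹; count-neutral).  HONEST FRAMING: a NON-VACUITY certificate at ONE datum (the flat one) for two named `Prop`s that nobody asserts; nothing of Bałaban's analysis asserted or
refuted; N12 NOT discharged; finite 𝕋⁴ at fixed ε; nothing continuum ∕ ℝ⁴ ∕ OS ∕ mass-gap ∕ Clay.  THEOREMS ONLY (0 `def`, 0 `instance`, 0 `sorry`).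

WHY.  The referees' A1–A6 column asks of every named `Prop` whether its body is inhabited in a meaningful regime (ref-K READ-569 on ✓p756040: «meaningful-regime witness not
exhibited»).  For the (E∕U) NAME itself dag-n12-c g30 typed the body at the flat datum (`…N12Thm1EUAtFlatDatumAllIndices.variationalThm1EUSepTop7MG_body_at_flatDatum`, ✓p744645).
THIS FILE does the same for the lane's two NEW tokens:
* the SUPPLY token `ApproxMinimiserExistsTop7MG` ([15] (11)–(13)): at `W := M˙(1)` the flat configuration `1` IS an approximate minimiser with (14) at every positive threshold — for
  every sequence `Ω`, top domain `Ω₀`, length `k` (§1);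
* the LIFT token `VariationalThm1EULiftTop7MG` ([15] (11)–(13) along the truncation): at `W := M˙(1)` and EVERY separated index `s` of length `k+1` with `0 < k`, `k+1 ≤ m+K`,
  `1 ≤ ν.M₁`, the witnesses `ε₀′ := ε₀`, `δ′ := δ`, `V₀ := M˙(1)` (the flat datum for the TRUNCATED problem `truncSeq s`) satisfy the token's conclusion — and its implication
  «every (8)-regular minimiser `U` of the truncated problem is an approximate minimiser with (14) at length `k+1`» is PROVED FOR EVERY SUCH `U` (not only `U = 1`): the class ranges at
  the scales `≤ k` coincide (`truncSeq_Ω_of_le`; the selector is read through `Ω_1` — hypothesis `hSup`, discharged for node00-def-R's `suppDomOfRecord` by `suppDomOfRecord_congr`),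
  the scale-`(k+1)` ranges sit inside the scale-`k` ones (`Ω_{k+1} ⊆ Ω_k`) with `η_k = L·η_{k+1}` and `δ_k ≤ 2δ_{k+1}`, whence the factors `2L²` (plaquettes) ∕ `2L³` (co-divergence) —
  so the witness needs **`2·L³ ≤ C₁`** (print's `C₁ = L³` ((13) p.280) times the comparability factor of the tree's per-scale thresholds; this is the kernel form of the lane's
  bus note I.≈31795 correcting the docstring guidance «`C₁ := L³`»); and AGREEMENT at scale `k+1` follows from agreement at scale `k` by the locality of Bałaban's averaging
  (`Averaging.local_dep`) plus the index geometry: a `k`-bond whose `(k+1)`-block is an endpoint of a `(k+1)`-bond meeting `Ω_{k+1}^{(k+1)}` has its centre in `Ω_k` (dag-n07-w3's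
  `mem_enlT_of_distSite_iterBlockOf_le_one` + `Sect2.SeqSeparated`; no block-union hypothesis needed) (§2–§3).
So at CONSISTENT data the interface-solvability demand (ℓ2) of the token module's docstring is met trivially, and the rest of (11)–(13) is exactly the bookkeeping described there.

HONEST SCOPE.  One datum; the tokens stay un-produced (producers: N07 for the one-length step, NODE 00 for supply∕lift at general data); count-neutral; K0⁷ ∕ K1⁹ NOT closed; N12 NOT
discharged; the YM mass gap (Clay) is NOT proved by any of this.

References: [15] = [Balaban1985Variational] Thm 1 p.279, (11) p.279, (12)–(14) p.280, (2)–(7) p.278; [6] = [Balaban1985RegularSpaces] (1.3)–(1.9) p.77; [III] = [Balaban1988Convergent]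
(2.1) p.254, (2.2) p.255, (2.10)–(2.12) p.256; [I] = [Balaban1987RG1] (0.1)–(0.4) pp.251–253.
-/


noncomputable section

open scoped Matrix.Norms.L2Operator

namespace Summit.QuantumFields.YangMills.BalabanUVNodes.N12EUStepTokensAtFlatDatum

open Set
open Literature.MathematicalPhysics.QuantumFieldTheory.Balaban1983to89
open Literature.MathematicalPhysics.QuantumFieldTheory.Balaban1983to89.Node00
open B15DeterminingSets (DetSet pts mem_pts bondsOf embIter genSet gammaRegion gammaRegion_self gammaRegion_zero gammaRegion_mid gammaRegion_of_gt AgreeOn avgFamily IsMinimizer MSField)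
open B14.Eq213MaximalDomains (side)
open B5Eq118OneStroke (iterBlockOf)
open B5Prop12FieldsLattice (distSite distSite_self)
open B5RowSumsP12Lattice (distSite_comm)
open B5Eq117TorusCarriers (Mk)
open B8Eq17ClassAkV1 (plaqsOf plaqsOf_mono)
open T4Continuum (T4Family)
open GaugeField (gaugeAct)
open B11Thm1ExistsUniqueStepTokensG (ApproxMinTop)
open B11Thm1ExistsUniqueInductionG (truncSeq truncSeq_Ω_of_le)
open Summit.QuantumFields.YangMills.BalabanUVNodes.N07RecordDomainsCollar (mem_enlT_of_distSite_iterBlockOf_le_one)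
open Summit.QuantumFields.YangMills.BalabanUVNodes.N12FlatHndRecordLetters (blockIter_eq_iterBlockOf)
open Summit.QuantumFields.YangMills.Theorems.FlatCubeQContraction (distSite_shift_le_one)
open Summit.QuantumFields.YangMills.BalabanUVNodes.N12Thm1RowAtFlatDatum (plaqSmallOn_one)
open Summit.QuantumFields.YangMills.BalabanUVNodes.N12Thm1EUAtFlatDatumAllIndices (dataSmall7PTop_flatDatum)
open B15Prop1Thm1LetterLengthZero (coDivSum_of_flat)
open B15Eq177GaugeInvariance (blockIter_embIter)

/-! ## §0  Numerics of the lattices of record -/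

section Numerics

variable (P : Params)

/-- `η_j > 0`. [cite: Balaban1987RG1, (1.1) p.260 (bookkeeping)] -/
private theorem eta_pos (j : ℕ) : 0 < P.eta j := pow_pos (inv_pos.mpr (Nat.cast_pos.mpr P.L_pos)) j

/-- `η_j = L·η_{j+1}`. [cite: Balaban1987RG1, (1.1) p.260 (bookkeeping)] -/
private theorem eta_eq_L_mul_eta_succ (j : ℕ) : P.eta j = (P.L : ℝ) * P.eta (j + 1) := by
  have hL : (P.L : ℝ) ≠ 0 := Nat.cast_ne_zero.mpr (Nat.pos_iff_ne_zero.mp P.L_pos)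
  unfold Params.eta
  rw [pow_succ]
  field_simp

/-- The bonds meeting a point set are MONOTONE in the set. [cite: Balaban1987RG1, (0.1) p.251 (bookkeeping)] -/
private theorem bondsOf_mono' {j : ℕ} {S T : Set (Site P j)} (h : S ⊆ T) : bondsOf S ⊆ bondsOf T :=
  fun _ hb => hb.elim (fun hs => Or.inl (h hs)) (fun ht => Or.inr (h ht))

end Numerics

/-! ## §1  The flat configuration is an approximate minimiser for the flat datum: the SUPPLY token's body at `W := M˙(1)` -/

section Supply

variable {P : Params} {N : ℕ} [NeZero N]

/-- **(14) AT THE FLAT DATUM**: for every averaging family, sequence `Ω`, top domain `Ω₀`, length `k` and POSITIVE thresholds `ρ_n`, the flat configuration `1` is an approximate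
minimiser with (14) for the datum `M˙(1)` — its plaquette variables are `1`, its co-divergences vanish, and it agrees with its own averages. [cite: Balaban1985Variational, (14) p.280, (2)–(3) p.278] -/
theorem approxMinTop_one_flat (av : ∀ j, Averaging P j (SU N)) (Ω : ℕ → Set (Site P 0)) (Ω₀ : Set (Site P 0)) (k : ℕ) {ρ : ℕ → ℝ}
    (hρ : ∀ n, n ≤ k → 0 < ρ n) : ApproxMinTop av Ω Ω₀ k ρ (avgFamily av 1) 1 := by
  refine ⟨fun n hn => plaqSmallOn_one (mul_pos (hρ n hn) (pow_pos (eta_pos P n) 2)), fun n hn b _ => ?_, fun _ _ _ => rfl⟩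
  rw [coDivSum_of_flat (fun p => by simp [GaugeField.plaqHol]) b.src b.dir, norm_zero]
  exact mul_pos (hρ n hn) (pow_pos (eta_pos P n) 3)

/-- ★ **THE SUPPLY TOKEN's BODY AT THE FLAT DATUM** (`ApproxMinimiserExistsTop7MG`'s conclusion at `W := M˙(1)`, every index): an approximate minimiser with (14) at the thresholds
`C₁B₃δ_n` EXISTS (`U₀ := 1`) as soon as `0 < C₁`, `0 < B₃`, `0 < δ_n`. [cite: Balaban1985Variational, (11) p.279, (14) p.280] -/
theorem approxMinimiserExistsTop7MG_body_at_flatDatum (av : ∀ j, Averaging P j (SU N)) (Ω : ℕ → Set (Site P 0)) (Ω₀ : Set (Site P 0)) (k : ℕ) {C₁ B₃ : ℝ}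
    {δ : ℕ → ℝ} (hC : 0 < C₁) (hB : 0 < B₃) (hδ : ∀ n, n ≤ k → 0 < δ n) :
    ∃ U₀ : GaugeField P 0 (SU N), ApproxMinTop av Ω Ω₀ k (fun n => C₁ * B₃ * δ n) (avgFamily av 1) U₀ :=
  ⟨1, approxMinTop_one_flat av Ω Ω₀ k fun n hn => mul_pos (mul_pos hC hB) (hδ n hn)⟩

end Supply

/-! ## §2  Index geometry: the `k`-bonds read by the average at a constrained `(k+1)`-bond have their centres in `Ω_k` -/

section Geometry

variable {P : Params}

/-- **THE BONDS READ AT A CONSTRAINED COARSE BOND ARE CONSTRAINED ONE SCALE DOWN.**  Let one layer of `L^{k+1}M₁`-cubes around `Ω_{k+1}` lie inside `Ω_k` (NODE 00's separation at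
level `k`, `1 ≤ M₁`, `k+1 ≤ m+K`).  If a `(k+1)`-bond `c` MEETS `Ω_{k+1}^{(k+1)}` and the `(k+1)`-block of a `k`-site `y` is an endpoint of `c` — exactly the bonds Bałaban's average at
`c` reads (`Averaging.local_dep`) — then the centre of `y` lies in `Ω_k`: the blocks of the two endpoints are within sup-distance `1`, so every block-mate of either lies within one cube
layer of `Ω_{k+1}` (dag-n07-w3's `mem_enlT_of_distSite_iterBlockOf_le_one`). [cite: Balaban1985RegularSpaces, (1.3)–(1.6) p.77; Balaban1987RG1, (0.1)–(0.4) pp.251–253; Balaban1988Convergent, (2.1) p.254] -/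
theorem embIter_mem_of_blockOf_eq_endpoint {M₁ : ℕ} (hM₁ : 1 ≤ M₁) {k : ℕ} (hkK : k + 1 ≤ P.m + P.K) {Ω : ℕ → Set (Site P 0)}
    (hsepk : Sect2.enlT P (side P.L M₁ (k + 1)) 1 (Ω (k + 1)) ⊆ Ω k)
    {c : PBond P (k + 1)} (hc : c ∈ bondsOf (pts (k + 1) (Ω (k + 1)))) {y : Site P k} (hy : blockOf y = c.src ∨ blockOf y = c.tgt) :
    embIter k y ∈ Ω k := by
  have key : ∀ z₀ : Site P (k + 1), embIter (k + 1) z₀ ∈ Ω (k + 1) → distSite (Mk P (k + 1)) z₀ (blockOf y) ≤ 1 → embIter k y ∈ Ω k := by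
    intro z₀ hz₀ hd
    apply hsepk
    have h1 : iterBlockOf (k + 1) (embIter (k + 1) z₀) = z₀ := by
      rw [← blockIter_eq_iterBlockOf]; exact blockIter_embIter (k + 1) hkK z₀
    have h2 : iterBlockOf (k + 1) (embIter k y) = blockOf y := by
      rw [← blockIter_eq_iterBlockOf, B14.Eq22Determines.blockIter_succ, blockIter_embIter k (by omega) y]
    have h := mem_enlT_of_distSite_iterBlockOf_le_one (n := k + 1) hkK hM₁ (Y := Ω (k + 1)) (x := embIter (k + 1) z₀) (x' := embIter k y) hz₀
      (by rw [h1, h2]; exact hd)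
    exact h
  rcases hc with hsrc | htgt
  · refine key c.src hsrc ?_
    rcases hy with h | h
    · rw [h, distSite_self]; norm_num
    · rw [h]; exact distSite_shift_le_one c.src c.dir
  · refine key c.tgt htgt ?_
    rcases hy with h | h
    · rw [h, distSite_comm]; exact distSite_shift_le_one c.src c.dir
    · rw [h, distSite_self]; norm_num

end Geometry

/-! ## §3  The LIFT token's body at the flat datum, every separated index of record -/

section Lift

variable {F : T4Family} {N : ℕ} [NeZero N]

/-- ★★ **THE LIFT TOKEN's BODY AT THE FLAT DATUM, EVERY SEPARATED INDEX, ANY SELECTOR READ THROUGH `Ω_1`** (`VariationalThm1EULiftTop7MG`'s conclusion at `W := M˙(1)`): for an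
index `s` of length `k+1` with `0 < k`, `k+1 ≤ m+K`, separated with `1 ≤ ν.M₁`, thresholds `δ_n` in the numeric range (positive, comparable by the factor `2`), `0 ≤ B₃` and
`2·L³ ≤ C₁`, the witnesses `ε₀′ := ε₀`, `δ′ := δ`, `V₀ := M˙(1)` satisfy: numeric rows, (7) for the truncated problem, and — FOR EVERY (8)-regular minimiser `U` of the truncated flat
problem — (14) at length `k+1` for the flat datum: the class ranges at the scales `≤ k` coincide, the top ranges sit inside the scale-`k` ones (`Ω_{k+1} ⊆ Ω_k`, `η_k = L·η_{k+1}`,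
`δ_k ≤ 2δ_{k+1}` ⇒ factors `2L²` ∕ `2L³`), and agreement at scale `k+1` follows from agreement at scale `k` by `Averaging.local_dep` + §2.
[cite: Balaban1985Variational, (11) p.279, (12)–(14) p.280, Thm 1 p.279; Balaban1985RegularSpaces, (1.3)–(1.9) p.77; Balaban1988Convergent, (2.1) p.254, (2.2) p.255, (2.10)–(2.12) p.256; Balaban1987RG1, (0.4) p.253] -/
theorem variationalThm1EULiftTop7MG_body_at_flatDatum
    (Sup : (ν : Stage7Numerics) → (K : ℕ) → (ℕ → Set (Site (F.P K) 0)) → Set (Site (F.P K) 0))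
    (ν : Stage7Numerics) (M : ℕ) (g : ℕ → ℝ) (K k : ℕ) (s : SeqOfRecord F ν M g K (k + 1))
    (hk0 : 0 < k) (hkK : k + 1 ≤ (F.P K).m + (F.P K).K) (hsep : Sect2.SeqSeparated ν.M₁ s) (hM : 0 < ν.M₁)
    (hSup : Sup ν K (truncSeq s).Ω = Sup ν K s.Ω)
    {ε₀ C₁ B₃ a₀ a₁ : ℝ} {δ : ℕ → ℝ}
    (hnum : ∀ n, n ≤ k + 1 → 0 < δ n ∧ δ n ≤ a₁ ∧ B₃ * δ n ≤ ε₀) (hc : ∀ n, n < k + 1 → δ n ≤ 2 * δ (n + 1))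
    (hc' : ∀ n, n < k + 1 → δ (n + 1) ≤ 2 * δ n) (hε : ε₀ ≤ a₀) (hB₃ : 0 ≤ B₃) (hC₁ : 2 * ((F.P K).L : ℝ) ^ 3 ≤ C₁) :
    ∃ (ε₀' : ℝ) (δ' : ℕ → ℝ) (V₀ : MSField (F.P K) (SU N)),
      (∀ n, n ≤ k → 0 < δ' n ∧ δ' n ≤ a₁ ∧ B₃ * δ' n ≤ ε₀') ∧ (∀ n, n < k → δ' n ≤ 2 * δ' (n + 1)) ∧ (∀ n, n < k → δ' (n + 1) ≤ 2 * δ' n) ∧ ε₀' ≤ a₀ ∧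
      Sect2.DataSmall7PTop (avOfRecord F N K) (truncSeq s).Ω (Sup ν K (truncSeq s).Ω) k δ' V₀ ∧
      ∀ U : GaugeField (F.P K) 0 (SU N),
        IsMinimizer (avOfRecord F N K)
            {U | (∀ n, n ≤ k → PlaqSmallOn (Sect2.omegaPlaqsTop (truncSeq s).Ω (Sup ν K (truncSeq s).Ω) n) (ε₀' * (F.P K).eta n ^ 2) U) ∧
              Sect2.CoDivClassOnTop (truncSeq s).Ω (Sup ν K (truncSeq s).Ω) k ε₀' U} (genSet (truncSeq s).Ω k) V₀ U →
        ((∀ n, n ≤ k → PlaqSmallOn (Sect2.omegaPlaqsTop (truncSeq s).Ω (Sup ν K (truncSeq s).Ω) n) (B₃ * δ' n * (F.P K).eta n ^ 2) U) ∧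
          ∀ n, n ≤ k → Sect2.CoDivSmallOn (Sect2.omegaBondsTop (truncSeq s).Ω (Sup ν K (truncSeq s).Ω) n) (B₃ * δ' n * (F.P K).eta n ^ 3) U) →
        ApproxMinTop (avOfRecord F N K) s.Ω (Sup ν K s.Ω) (k + 1) (fun n => C₁ * B₃ * δ n) (avgFamily (avOfRecord F N K) 1) U := by
  refine ⟨ε₀, δ, avgFamily (avOfRecord F N K) 1, fun n hn => hnum n (by omega), fun n hn => hc n (by omega), fun n hn => hc' n (by omega), hε,
    dataSmall7PTop_flatDatum K _ _ k (fun n hn => (hnum n (by omega)).1), fun U hU h8 => ?_⟩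
  -- numerics
  have hL1 : (1 : ℝ) ≤ (F.P K).L := by exact_mod_cast (F.P K).L_pos
  have hL0 : (0 : ℝ) ≤ (F.P K).L := zero_le_one.trans hL1
  have hC3 : 2 * ((F.P K).L : ℝ) ^ 2 ≤ C₁ := le_trans (by nlinarith [pow_le_pow_right₀ hL1 (show 2 ≤ 3 by norm_num)]) hC₁
  have hC1 : (1 : ℝ) ≤ C₁ := le_trans (by nlinarith [one_le_pow₀ (M₀ := ℝ) hL1 (n := 3)]) hC₁
  have hη : ∀ j, 0 ≤ (F.P K).eta j := fun j => (eta_pos (F.P K) j).le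
  have hδ0 : ∀ n, n ≤ k + 1 → 0 ≤ δ n := fun n hn => (hnum n hn).1.le
  -- the class ranges at the scales `≤ k` coincide; the top ranges sit inside the scale-`k` ones
  have hΩP : ∀ n, n ≤ k → Sect2.omegaPlaqsTop s.Ω (Sup ν K s.Ω) n = Sect2.omegaPlaqsTop (truncSeq s).Ω (Sup ν K (truncSeq s).Ω) n := by
    intro n hn; unfold Sect2.omegaPlaqsTop; rw [hSup, truncSeq_Ω_of_le s hn]
  have hΩB : ∀ n, n ≤ k → Sect2.omegaBondsTop s.Ω (Sup ν K s.Ω) n = Sect2.omegaBondsTop (truncSeq s).Ω (Sup ν K (truncSeq s).Ω) n := by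
    intro n hn; unfold Sect2.omegaBondsTop; rw [hSup, truncSeq_Ω_of_le s hn]
  have hΩsub : s.Ω (k + 1) ⊆ s.Ω k := s.chain.Ω_succ_subset_Ω hk0 (lt_add_one k)
  have hkne : k ≠ 0 := by omega
  have hPtop : Sect2.omegaPlaqsTop s.Ω (Sup ν K s.Ω) (k + 1) ⊆ Sect2.omegaPlaqsTop (truncSeq s).Ω (Sup ν K (truncSeq s).Ω) k := by
    rw [← hΩP k le_rfl]; unfold Sect2.omegaPlaqsTop; rw [if_neg (Nat.succ_ne_zero k), if_neg hkne]; exact plaqsOf_mono hΩsub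
  have hBtop : Sect2.omegaBondsTop s.Ω (Sup ν K s.Ω) (k + 1) ⊆ Sect2.omegaBondsTop (truncSeq s).Ω (Sup ν K (truncSeq s).Ω) k := by
    rw [← hΩB k le_rfl]; unfold Sect2.omegaBondsTop; rw [if_neg (Nat.succ_ne_zero k), if_neg hkne]; exact bondsOf_mono' (F.P K) hΩsub
  -- thresholds: `B₃δ_n ≤ C₁B₃δ_n` below the top, and `B₃δ_k·η_k^p ≤ C₁B₃δ_{k+1}·η_{k+1}^p` (`p = 2, 3`) at the top
  have hmono : ∀ n, n ≤ k + 1 → ∀ (t : ℝ), 0 ≤ t → B₃ * δ n * t ≤ C₁ * B₃ * δ n * t := by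
    intro n hn t ht
    calc B₃ * δ n * t = 1 * (B₃ * δ n * t) := (one_mul _).symm
      _ ≤ C₁ * (B₃ * δ n * t) := mul_le_mul_of_nonneg_right hC1 (mul_nonneg (mul_nonneg hB₃ (hδ0 n hn)) ht)
      _ = C₁ * B₃ * δ n * t := by ring
  have hηk : (F.P K).eta k = ((F.P K).L : ℝ) * (F.P K).eta (k + 1) := eta_eq_L_mul_eta_succ (F.P K) k
  have hδk : δ k ≤ 2 * δ (k + 1) := hc k (lt_add_one k)
  have htop : ∀ (p : ℕ), 2 * ((F.P K).L : ℝ) ^ p ≤ C₁ →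
      B₃ * δ k * (F.P K).eta k ^ p ≤ C₁ * B₃ * δ (k + 1) * (F.P K).eta (k + 1) ^ p := by
    intro p hCp
    have hηp : 0 ≤ (F.P K).eta (k + 1) ^ p := pow_nonneg (hη (k + 1)) p
    calc B₃ * δ k * (F.P K).eta k ^ p = (B₃ * (F.P K).eta (k + 1) ^ p) * (δ k * ((F.P K).L : ℝ) ^ p) := by rw [hηk, mul_pow]; ring
      _ ≤ (B₃ * (F.P K).eta (k + 1) ^ p) * (2 * δ (k + 1) * ((F.P K).L : ℝ) ^ p) :=
          mul_le_mul_of_nonneg_left (mul_le_mul_of_nonneg_right hδk (pow_nonneg hL0 p)) (mul_nonneg hB₃ hηp)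
      _ = (2 * ((F.P K).L : ℝ) ^ p) * (B₃ * δ (k + 1) * (F.P K).eta (k + 1) ^ p) := by ring
      _ ≤ C₁ * (B₃ * δ (k + 1) * (F.P K).eta (k + 1) ^ p) := mul_le_mul_of_nonneg_right hCp (mul_nonneg (mul_nonneg hB₃ (hδ0 (k + 1) le_rfl)) hηp)
      _ = C₁ * B₃ * δ (k + 1) * (F.P K).eta (k + 1) ^ p := by ring
  refine ⟨fun n hn => ?_, fun n hn => ?_, fun j b hb => ?_⟩
  · -- (14), plaquettes
    rcases Nat.lt_or_ge n (k + 1) with hlt | hge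
    · have hn' : n ≤ k := by omega
      rw [hΩP n hn']
      exact fun p hp => (h8.1 n hn' p hp).trans_le (hmono n hn _ (pow_nonneg (hη n) 2))
    · obtain rfl : n = k + 1 := le_antisymm hn hge
      exact fun p hp => (h8.1 k le_rfl p (hPtop hp)).trans_le (htop 2 hC3)
  · -- (14), co-divergence
    rcases Nat.lt_or_ge n (k + 1) with hlt | hge
    · have hn' : n ≤ k := by omega
      rw [hΩB n hn']
      exact fun b hb => (h8.2 n hn' b hb).trans_le (hmono n hn _ (pow_nonneg (hη n) 3))
    · obtain rfl : n = k + 1 := le_antisymm hn hge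
      exact fun b hb => (h8.2 k le_rfl b (hBtop hb)).trans_le (htop 3 hC₁)
  · -- (14), agreement with `M˙(1)` on `genSet s.Ω (k+1)`
    rcases Nat.lt_or_ge j (k + 1) with hlt | hge
    · -- below the top: the member `Γ_j` of `s` sits inside the member `Γ′_j` of the truncated index
      have hsub : genSet s.Ω (k + 1) j ⊆ genSet (truncSeq s).Ω k j := by
        show pts j (gammaRegion s.Ω (k + 1) j) ⊆ pts j (gammaRegion (truncSeq s).Ω k j)
        apply Set.preimage_mono
        rcases Nat.eq_zero_or_pos j with rfl | hj0
        · rw [gammaRegion_zero s.Ω (Nat.succ_pos k), gammaRegion_zero (truncSeq s).Ω hk0, truncSeq_Ω_of_le s hk0]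
        · rcases Nat.lt_or_ge j k with hjk | hjk
          · rw [gammaRegion_mid s.Ω hj0 hlt, gammaRegion_mid (truncSeq s).Ω hj0 hjk, truncSeq_Ω_of_le s hjk.le, truncSeq_Ω_of_le s (Nat.succ_le_of_lt hjk)]
          · obtain rfl : j = k := le_antisymm (by omega) hjk
            rw [gammaRegion_mid s.Ω hj0 hlt, gammaRegion_self, truncSeq_Ω_of_le s le_rfl]
            exact fun x hx => hx.1
      exact hU.2.1 j b (bondsOf_mono' (F.P K) hsub hb)
    · rcases Nat.eq_or_lt_of_le hge with heq | hgt
      swap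
      · -- above the top there is no member
        exfalso
        change b ∈ bondsOf (pts j (gammaRegion s.Ω (k + 1) j)) at hb
        rw [gammaRegion_of_gt s.Ω hgt] at hb
        rcases hb with h | h <;> exact absurd (mem_pts.mp h) (Set.notMem_empty _)
      -- the top scale: locality of the averaging + §2
      subst heq
      have hb' : b ∈ bondsOf (pts (k + 1) (s.Ω (k + 1))) := by
        change b ∈ bondsOf (pts (k + 1) (gammaRegion s.Ω (k + 1) (k + 1))) at hb
        rwa [gammaRegion_self] at hb
      show (avOfRecord F N K k).avg (Averaging.iter (avOfRecord F N K) k U) b = (avOfRecord F N K k).avg (Averaging.iter (avOfRecord F N K) k 1) b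
      refine (avOfRecord F N K k).local_dep hkK _ _ b fun b' hb'src => ?_
      have hmem : embIter k b'.src ∈ s.Ω k := embIter_mem_of_blockOf_eq_endpoint hM hkK (hsep k hk0 (lt_add_one k)) hb' hb'src
      have hb'' : b' ∈ bondsOf (genSet (truncSeq s).Ω k k) := by
        change b' ∈ bondsOf (pts k (gammaRegion (truncSeq s).Ω k k))
        rw [gammaRegion_self, truncSeq_Ω_of_le s le_rfl]
        exact Or.inl hmem
      exact hU.2.1 k b' hb''

/-- ★★ **`CoP` EDITION — THE LIFT TOKEN's BODY AT THE FLAT DATUM ON THE SUPPORT OF RECORD** (`VariationalThm1EULiftCoP7MG`): node00-def-R's selector `suppDomOfRecord F ν K Ω =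
hullD … (Ω 1)` reads `Ω_1` only, which the truncation keeps (`0 < k`). [cite: Balaban1985Variational, (11) p.279, (12)–(14) p.280; Balaban1988Convergent, p.255, (2.12) p.256] -/
theorem variationalThm1EULiftCoP7MG_body_at_flatDatum
    (ν : Stage7Numerics) (M : ℕ) (g : ℕ → ℝ) (K k : ℕ) (s : SeqOfRecord F ν M g K (k + 1))
    (hk0 : 0 < k) (hkK : k + 1 ≤ (F.P K).m + (F.P K).K) (hsep : Sect2.SeqSeparated ν.M₁ s) (hM : 0 < ν.M₁)
    {ε₀ C₁ B₃ a₀ a₁ : ℝ} {δ : ℕ → ℝ}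
    (hnum : ∀ n, n ≤ k + 1 → 0 < δ n ∧ δ n ≤ a₁ ∧ B₃ * δ n ≤ ε₀) (hc : ∀ n, n < k + 1 → δ n ≤ 2 * δ (n + 1))
    (hc' : ∀ n, n < k + 1 → δ (n + 1) ≤ 2 * δ n) (hε : ε₀ ≤ a₀) (hB₃ : 0 ≤ B₃) (hC₁ : 2 * ((F.P K).L : ℝ) ^ 3 ≤ C₁) :
    ∃ (ε₀' : ℝ) (δ' : ℕ → ℝ) (V₀ : MSField (F.P K) (SU N)),
      (∀ n, n ≤ k → 0 < δ' n ∧ δ' n ≤ a₁ ∧ B₃ * δ' n ≤ ε₀') ∧ (∀ n, n < k → δ' n ≤ 2 * δ' (n + 1)) ∧ (∀ n, n < k → δ' (n + 1) ≤ 2 * δ' n) ∧ ε₀' ≤ a₀ ∧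
      Sect2.DataSmall7PTop (avOfRecord F N K) (truncSeq s).Ω (suppDomOfRecord F ν K (truncSeq s).Ω) k δ' V₀ ∧
      ∀ U : GaugeField (F.P K) 0 (SU N),
        IsMinimizer (avOfRecord F N K)
            {U | (∀ n, n ≤ k → PlaqSmallOn (Sect2.omegaPlaqsTop (truncSeq s).Ω (suppDomOfRecord F ν K (truncSeq s).Ω) n) (ε₀' * (F.P K).eta n ^ 2) U) ∧
              Sect2.CoDivClassOnTop (truncSeq s).Ω (suppDomOfRecord F ν K (truncSeq s).Ω) k ε₀' U} (genSet (truncSeq s).Ω k) V₀ U →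
        ((∀ n, n ≤ k → PlaqSmallOn (Sect2.omegaPlaqsTop (truncSeq s).Ω (suppDomOfRecord F ν K (truncSeq s).Ω) n) (B₃ * δ' n * (F.P K).eta n ^ 2) U) ∧
          ∀ n, n ≤ k → Sect2.CoDivSmallOn (Sect2.omegaBondsTop (truncSeq s).Ω (suppDomOfRecord F ν K (truncSeq s).Ω) n) (B₃ * δ' n * (F.P K).eta n ^ 3) U) →
        ApproxMinTop (avOfRecord F N K) s.Ω (suppDomOfRecord F ν K s.Ω) (k + 1) (fun n => C₁ * B₃ * δ n) (avgFamily (avOfRecord F N K) 1) U :=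
  variationalThm1EULiftTop7MG_body_at_flatDatum (fun ν K Ω => suppDomOfRecord F ν K Ω) ν M g K k s hk0 hkK hsep hM
    (suppDomOfRecord_congr (F := F) ν K (truncSeq_Ω_of_le s hk0)) hnum hc hc' hε hB₃ hC₁

end Lift

end Summit.QuantumFields.YangMills.BalabanUVNodes.N12EUStepTokensAtFlatDatum

end

noncomputable section

/-! ## §4  v1.1 (APPEND-ONLY) — the LIFT body's binder block is INHABITED: the separated TOP index of record (K0's `exists_seq_top`) -/

section InhabitedV11

open Literature.MathematicalPhysics.QuantumFieldTheory.Balaban1983to89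
open Literature.MathematicalPhysics.QuantumFieldTheory.Balaban1983to89.Node00
open Literature.MathematicalPhysics.QuantumFieldTheory.Balaban1983to89.B15DeterminingSets (genSet AgreeOn avgFamily IsMinimizer MSField)
open Literature.MathematicalPhysics.QuantumFieldTheory.Balaban1983to89.T4Continuum (T4Family)
open Literature.MathematicalPhysics.QuantumFieldTheory.Balaban1983to89.B11Thm1ExistsUniqueStepTokensG (ApproxMinTop)
open Literature.MathematicalPhysics.QuantumFieldTheory.Balaban1983to89.B11Thm1ExistsUniqueInductionG (truncSeq)
open Summit.QuantumFields.YangMills.Theorems.K0TopIndexWrapGeometry (exists_seq_top)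
open Summit.QuantumFields.YangMills.BalabanUVNodes.N12EUStepTokensAtFlatDatum (variationalThm1EULiftCoP7MG_body_at_flatDatum)

variable {F : T4Family} {N : ℕ} [NeZero N]

/-- ★★ **v1.1 — THE LIFT TOKEN's BODY AT THE FLAT DATUM IS INHABITED ON THE SUPPORT OF RECORD** (A2 for `VariationalThm1EULiftCoP7MG`, the referee's «lift: NOT exhibited» of
READ-548 answered): for EVERY family `F`, numerics `ν` with `0 < ν.M₁`, cube letter `M ≥ 1`, history `g`, torus `K` and length `k+1` with `0 < k`, `k+1 ≤ m+K`, thresholds in the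
numeric range, `0 ≤ B₃`, `2·L³ ≤ C₁`, there IS a separated (2.18) index of record of length `k+1` — the TOP index `Ω_j = T_η` (dag-n21-c ∕ K0's `exists_seq_top`) — at which §3's
body holds with the witnesses `(ε₀, δ, M˙(1))`. [cite: Balaban1985Variational, (11) p.279, (12)–(14) p.280; Balaban1988Convergent, (2.1) p.254, (2.18) p.257] -/
theorem Summit.QuantumFields.YangMills.BalabanUVNodes.N12EUStepTokensAtFlatDatum.variationalThm1EULiftCoP7MG_binders_inhabited_flat
    (ν : Stage7Numerics) (hM₁ : 0 < ν.M₁) {M : ℕ} (hM : 1 ≤ M) (g : ℕ → ℝ) (K k : ℕ) (hk0 : 0 < k) (hkK : k + 1 ≤ (F.P K).m + (F.P K).K)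
    {ε₀ C₁ B₃ a₀ a₁ : ℝ} {δ : ℕ → ℝ}
    (hnum : ∀ n, n ≤ k + 1 → 0 < δ n ∧ δ n ≤ a₁ ∧ B₃ * δ n ≤ ε₀) (hc : ∀ n, n < k + 1 → δ n ≤ 2 * δ (n + 1))
    (hc' : ∀ n, n < k + 1 → δ (n + 1) ≤ 2 * δ n) (hε : ε₀ ≤ a₀) (hB₃ : 0 ≤ B₃) (hC₁ : 2 * ((F.P K).L : ℝ) ^ 3 ≤ C₁) :
    ∃ s : SeqOfRecord F ν M g K (k + 1), Sect2.SeqSeparated ν.M₁ s ∧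
      ∃ (ε₀' : ℝ) (δ' : ℕ → ℝ) (V₀ : MSField (F.P K) (SU N)),
        (∀ n, n ≤ k → 0 < δ' n ∧ δ' n ≤ a₁ ∧ B₃ * δ' n ≤ ε₀') ∧ (∀ n, n < k → δ' n ≤ 2 * δ' (n + 1)) ∧ (∀ n, n < k → δ' (n + 1) ≤ 2 * δ' n) ∧ ε₀' ≤ a₀ ∧
        Sect2.DataSmall7PTop (avOfRecord F N K) (truncSeq s).Ω (suppDomOfRecord F ν K (truncSeq s).Ω) k δ' V₀ ∧
        ∀ U : GaugeField (F.P K) 0 (SU N),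
          IsMinimizer (avOfRecord F N K)
              {U | (∀ n, n ≤ k → PlaqSmallOn (Sect2.omegaPlaqsTop (truncSeq s).Ω (suppDomOfRecord F ν K (truncSeq s).Ω) n) (ε₀' * (F.P K).eta n ^ 2) U) ∧
                Sect2.CoDivClassOnTop (truncSeq s).Ω (suppDomOfRecord F ν K (truncSeq s).Ω) k ε₀' U} (genSet (truncSeq s).Ω k) V₀ U →
          ((∀ n, n ≤ k → PlaqSmallOn (Sect2.omegaPlaqsTop (truncSeq s).Ω (suppDomOfRecord F ν K (truncSeq s).Ω) n) (B₃ * δ' n * (F.P K).eta n ^ 2) U) ∧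
            ∀ n, n ≤ k → Sect2.CoDivSmallOn (Sect2.omegaBondsTop (truncSeq s).Ω (suppDomOfRecord F ν K (truncSeq s).Ω) n) (B₃ * δ' n * (F.P K).eta n ^ 3) U) →
          ApproxMinTop (avOfRecord F N K) s.Ω (suppDomOfRecord F ν K s.Ω) (k + 1) (fun n => C₁ * B₃ * δ n) (avgFamily (avOfRecord F N K) 1) U := by
  obtain ⟨s, -, hsep⟩ := exists_seq_top F ν hM g K (k + 1)
  exact ⟨s, hsep, variationalThm1EULiftCoP7MG_body_at_flatDatum ν M g K k s hk0 hkK hsep hM₁ hnum hc hc' hε hB₃ hC₁⟩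

end InhabitedV11

end
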